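import Literature.Barriers.CriticalPhenomena.WeaklySAWSojournSimplex
import HarnessLib

/-!
# The continuous-time weakly self-avoiding walk: the mean-square displacement `E₀^{g,T}|X(T)|²`
# is a genuine positive real number (non-vacuity of the open statement `BBS2015_endToEndConjecture`)

Companion (theorems only; no definitions, no named facts) to `WeaklySAWFourDimLogCorrections.lean`
(namespace `Literature.Barriers.CriticalPhenomena.CTWSAW`: the jump-chain definitions
`pathIntegral`, `weightedExpectation`, `survival = c_{g,T} = E₀(e^{-gI(T)})`,
`momentTwo = E₀(e^{-gI(T)}|X(T)|²)`, `meanSqDisplacement = E₀^{g,T}|X(T)|²`) on top of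
`WeaklySAWFourDimLogCorrectionsProofs.lean` (`volume_sojournSet`: `|Δ_k(T)| = T^k/k!`; `layer_le`:
the `k`-jump layer of a weight `≤ 1` is `≤ (2d)^k T^k/k!`; `survival_le_one`) and
`WeaklySAWSojournSimplex.lean` (`measurable_sojourns`).

That file registers the OPEN CONJECTURE `BBS2015_endToEndConjecture` — Bauerschmidt–Brydges–Slade
2015, §1.3: "it is believed that for `p ≥ 1`, `(E₀^{g,T}|X(T)|^p)^{1/p} ∼ c_{g,p} T^{1/2}(log T)^{1/8}`",
vendored for `p = 2` as `meanSqDisplacement 4 g T / (c T (log T)^{1/4}) → 1`; proved in print only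
for the hierarchical model (Bauerschmidt–Brydges–Slade 2019, §11.3). It is not a theorem anywhere and
is NOT proved here. What this file proves is that the quantity the conjecture speaks about is an
honest one — the subject of the conjecture is neither a junk value nor degenerate:

* `pathIntegral_pos`: every skeleton contributes, `∫_{Δ_k(T)} e^{-gI} ds > 0` for `T > 0` (the
  integrand is positive and `|Δ_k(T)| = T^k/k! > 0`);
* `survival_pos`: `c_{g,T} > 0` (`T > 0`, every `g`; the no-jump skeleton), so the normalising
  denominator of `E^{g,T}` is a positive finite number (`survival_le_one`);
* `normSq_le_of_mem_box` (`|x|² ≤ d k²` on `{-k,…,k}^d`), `momentLayer_le` and **`momentTwo_le`**: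
  `E₀(e^{-gI(T)}|X(T)|²) ≤ d·e^{6dT} < ∞` (`g ≥ 0`, `T > 0`; crude: `|X(T)|² ≤ d k²` after `k` jumps,
  `k² ≤ 4^k`, and the Poisson sum `Σ_k (8dT)^k/k! = e^{8dT}`), `momentTwo_lt_top`;
* `momentTwo_pos`: `E₀(e^{-gI(T)}|X(T)|²) > 0` for `d ≥ 1`, `T > 0` (the one-step skeleton `0 → e₀`);
* hence **`meanSqDisplacement_pos`**: `0 < E₀^{g,T}|X(T)|² = momentTwo.toReal / survival.toReal`
  (`meanSqDisplacement_eq_div`) for `d ≥ 1`, `g ≥ 0`, `T > 0` — in particular for the `d = 4`,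
  small-`g` regime of the conjecture, whose ratio `E₀^{g,T}|X(T)|² / (c T (log T)^{1/4})` is therefore
  a quotient of positive reals for `T > 1`.

Nothing here bears on the TRUTH of the conjecture (open: "our present estimates do not suffice",
BBS 2015 §1.3); these are the elementary sanity properties of the measure `E^{g,T}_0` of §1.3.

## References

* R. Bauerschmidt, D. C. Brydges, G. Slade, *Logarithmic correction for the susceptibility of the
  4-dimensional weakly self-avoiding walk: a renormalisation group analysis*, CMP 337 (2015)
  817–877, arXiv:1403.7422, §1.1 (the model, `c_T`), §1.3 (the measure `E^{g,T}_a` and the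
  believed end-to-end law). [cite: BauerschmidtBrydgesSlade2015LogCorr]
* R. Bauerschmidt, D. C. Brydges, G. Slade, *Introduction to a renormalisation group method*,
  LNM 2242 (2019), arXiv:1907.05474, §11.3. [cite: BauerschmidtBrydgesSlade2019RG]
-/

noncomputable section

open MeasureTheory Filter Topology Set Literature.Probability.LatticeModels
open Literature.Probability.RandomPlanarGeometry.SAW.Zd (normSq mem_box_of_walk)
open scoped ENNReal BigOperators Nat

namespace Literature.Barriers.CriticalPhenomena.CTWSAW

variable {d : ℕ}

/-! ### Every skeleton contributes: `∫_{Δ_k(T)} e^{-gI} ds > 0` -/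

/-- The self-intersection local time is a measurable function of the sojourns (local copy of
`measurable_selfIntersection` of `WeaklySAWCriticalNuLowerBound.lean`, to keep the imports of this
file light). [folklore] -/
private theorem measurable_selfIntersection_aux (T : ℝ) {x : Site d} (ω : (zdGraph d).Walk 0 x) :
    Measurable fun s => selfIntersection T ω s := by
  unfold selfIntersection
  refine Finset.measurable_sum _ fun i _ => Finset.measurable_sum _ fun j _ => ?_
  by_cases h : ω.getVert i = ω.getVert j
  · simp only [h, if_true]
    exact (measurable_sojourns T _ i).mul (measurable_sojourns T _ j)
  · simp only [h, if_false]
    exact measurable_const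

/-- **Every skeleton has a positive path integral**: `∫_{Δ_k(T)} e^{-gI(ω,s)} ds > 0` for `T > 0`
(any `g`): the integrand is everywhere positive and `|Δ_k(T)| = T^k/k! > 0`.
[cite: BauerschmidtBrydgesSlade2015LogCorr, §1.1 (two-point function)] -/
theorem pathIntegral_pos (g : ℝ) {T : ℝ} (hT : 0 < T) {x : Site d} (ω : (zdGraph d).Walk 0 x) :
    0 < pathIntegral g T ω := by
  unfold pathIntegral
  rw [setLIntegral_pos_iff
    (((measurable_selfIntersection_aux T ω).const_mul (-g)).exp.ennreal_ofReal)]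
  have hsupp : Function.support
      (fun s : Fin ω.length → ℝ => ENNReal.ofReal (Real.exp (-g * selfIntersection T ω s))) = univ := by
    refine eq_univ_of_forall fun s => ?_
    rw [Function.mem_support]
    exact (ENNReal.ofReal_pos.2 (Real.exp_pos _)).ne'
  rw [hsupp, univ_inter, volume_sojournSet, if_pos hT]
  exact ENNReal.ofReal_pos.2 (by positivity)

/-! ### `c_{g,T} > 0` -/

/-- **`c_{g,T} = E₀(e^{-gI(T)}) > 0`** for `T > 0` (every `d`, every `g`): the no-jump skeleton
alone contributes `e^{-2dT} ∫_{Δ₀(T)} e^{-gI} > 0`. With `survival_le_one`, `c_{g,T} ∈ (0, 1]` for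
`g ≥ 0`: the normalisation of the measure `E^{g,T}_0` of §1.3 is a positive finite number.
[cite: BauerschmidtBrydgesSlade2015LogCorr, §1.1 (definition of c_T) and §1.3 (the measure E^{g,T})] -/
theorem survival_pos (d : ℕ) (g : ℝ) {T : ℝ} (hT : 0 < T) : 0 < survival d g T := by
  unfold survival weightedExpectation
  refine ENNReal.mul_pos (ENNReal.ofReal_pos.2 (Real.exp_pos _)).ne' (ne_of_gt ?_)
  have hnil : (SimpleGraph.Walk.nil : (zdGraph d).Walk (0 : Site d) 0) ∈
      (zdGraph d).finsetWalkLength 0 (0 : Site d) 0 :=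
    SimpleGraph.mem_finsetWalkLength_iff.2 SimpleGraph.Walk.length_nil
  have hbox : (0 : Site d) ∈ box d 0 := by simp [mem_box]
  calc (0 : ℝ≥0∞) < 1 * pathIntegral g T (SimpleGraph.Walk.nil : (zdGraph d).Walk (0 : Site d) 0) := by
        rw [one_mul]; exact pathIntegral_pos g hT _
    _ ≤ ∑ ω ∈ (zdGraph d).finsetWalkLength 0 (0 : Site d) 0, 1 * pathIntegral g T ω :=
        Finset.single_le_sum (f := fun ω => 1 * pathIntegral g T ω) (fun _ _ => bot_le) hnil
    _ ≤ ∑ x ∈ box d 0, ∑ ω ∈ (zdGraph d).finsetWalkLength 0 (0 : Site d) x,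
          1 * pathIntegral g T ω :=
        Finset.single_le_sum (f := fun x => ∑ ω ∈ (zdGraph d).finsetWalkLength 0 (0 : Site d) x,
          1 * pathIntegral g T ω) (fun _ _ => bot_le) hbox
    _ ≤ ∑' k, ∑ x ∈ box d k, ∑ ω ∈ (zdGraph d).finsetWalkLength k (0 : Site d) x,
          (1 : ℝ≥0∞) * pathIntegral g T ω :=
        ENNReal.le_tsum (f := fun k => ∑ x ∈ box d k,
          ∑ ω ∈ (zdGraph d).finsetWalkLength k (0 : Site d) x, 1 * pathIntegral g T ω) 0

/-- `c_{g,T} ≠ 0` for `T > 0`. [cite: BauerschmidtBrydgesSlade2015LogCorr, §1.1 (definition of c_T)] -/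
theorem survival_ne_zero (d : ℕ) (g : ℝ) {T : ℝ} (hT : 0 < T) : survival d g T ≠ 0 :=
  (survival_pos d g hT).ne'

/-! ### `E₀(e^{-gI(T)}|X(T)|²) < ∞` -/

/-- `|x|² ≤ d k²` on the box `{-k,…,k}^d` (where every `k`-step walk from `0` ends). [folklore] -/
theorem normSq_le_of_mem_box {k : ℕ} {x : Site d} (hx : x ∈ box d k) :
    normSq x ≤ d * (k : ℝ) ^ 2 := by
  unfold normSq
  rw [mem_box] at hx
  calc ∑ i, ((x i : ℝ)) ^ 2 ≤ ∑ _i : Fin d, (k : ℝ) ^ 2 := by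
        refine Finset.sum_le_sum fun i _ => ?_
        have h1 : -(k : ℝ) ≤ x i := by exact_mod_cast (hx i).1
        have h2 : (x i : ℝ) ≤ k := by exact_mod_cast (hx i).2
        exact sq_le_sq' h1 h2
    _ = d * (k : ℝ) ^ 2 := by simp

/-- The `k`-jump layer of `E₀(e^{-gI(T)}|X(T)|²)` is at most `d k² · (2d)^k T^k/k!` (`g ≥ 0`,
`T > 0`). [folklore] -/
theorem momentLayer_le (d k : ℕ) {g : ℝ} (hg : 0 ≤ g) {T : ℝ} (hT : 0 < T) :
    ∑ x ∈ box d k, ∑ ω ∈ (zdGraph d).finsetWalkLength k (0 : Site d) x,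
        ENNReal.ofReal (normSq x) * pathIntegral g T ω
      ≤ ENNReal.ofReal (d * (k : ℝ) ^ 2) * ((2 * d : ℝ≥0∞) ^ k * ENNReal.ofReal (T ^ k / k !)) := by
  calc ∑ x ∈ box d k, ∑ ω ∈ (zdGraph d).finsetWalkLength k (0 : Site d) x,
        ENNReal.ofReal (normSq x) * pathIntegral g T ω
      ≤ ∑ x ∈ box d k, ∑ ω ∈ (zdGraph d).finsetWalkLength k (0 : Site d) x,
          ENNReal.ofReal (d * (k : ℝ) ^ 2) * (1 * pathIntegral g T ω) := by
        refine Finset.sum_le_sum fun x hx => Finset.sum_le_sum fun ω _ => ?_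
        rw [one_mul]
        exact mul_le_mul' (ENNReal.ofReal_le_ofReal (normSq_le_of_mem_box hx)) le_rfl
    _ = ENNReal.ofReal (d * (k : ℝ) ^ 2) * ∑ x ∈ box d k,
          ∑ ω ∈ (zdGraph d).finsetWalkLength k (0 : Site d) x, 1 * pathIntegral g T ω := by
        simp_rw [Finset.mul_sum]
    _ ≤ _ := mul_le_mul' le_rfl (layer_le d k hg hT fun _ => le_rfl)

/-- `k² ≤ 4^k`. [folklore] -/
private theorem sq_le_four_pow (k : ℕ) : (k : ℝ) ^ 2 ≤ 4 ^ k := by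
  have h : (k : ℝ) < 2 ^ k := by exact_mod_cast Nat.lt_two_pow_self
  calc (k : ℝ) ^ 2 ≤ (2 ^ k) ^ 2 := by gcongr
    _ = 4 ^ k := by rw [← pow_mul, mul_comm, pow_mul]; norm_num

/-- `Σ_k y^k/k! = e^y` in `ℝ≥0∞`, for `y ≥ 0` (local copy of `tsum_ofReal_pow_div_factorial` of
`WeaklySAWFourDimLogCorrectionsDecay.lean`). [folklore] -/
private theorem tsum_ofReal_pow_div_factorial_aux {y : ℝ} (hy : 0 ≤ y) :
    ∑' k : ℕ, ENNReal.ofReal (y ^ k / k !) = ENNReal.ofReal (Real.exp y) := by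
  rw [Real.exp_eq_exp_ℝ, congr_fun NormedSpace.exp_eq_tsum_div y]
  exact (ENNReal.ofReal_tsum_of_nonneg (fun k => by positivity)
    (Real.summable_pow_div_factorial y)).symm

/-- The layer constant with `k² ≤ 4^k` absorbed: `4^k (2d)^k T^k/k! = (8dT)^k/k!` in `ℝ≥0∞`.
[folklore] -/
private theorem layerConst_eq (d k : ℕ) (T : ℝ) :
    ENNReal.ofReal (4 ^ k) * ((2 * d : ℝ≥0∞) ^ k * ENNReal.ofReal (T ^ k / k !)) =
      ENNReal.ofReal ((4 * (2 * d) * T) ^ k / k !) := by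
  rw [two_mul_natCast_eq_ofReal, ← ENNReal.ofReal_pow (by positivity),
    ← ENNReal.ofReal_mul (by positivity), ← ENNReal.ofReal_mul (by positivity)]
  congr 1
  rw [← mul_assoc, ← mul_pow, ← mul_div_assoc, ← mul_pow]

/-- **`E₀(e^{-gI(T)}|X(T)|²) ≤ d·e^{6dT}`** for `g ≥ 0`, `T > 0` (crude but finite:
`|X(T)|² ≤ d k²` after `k` jumps, `k² ≤ 4^k`, `e^{-2dT} Σ_k (8dT)^k/k! = e^{6dT}`).
[cite: BauerschmidtBrydgesSlade2015LogCorr, §1.3 (the measure E^{g,T}, p = 2)] -/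
theorem momentTwo_le (d : ℕ) {g : ℝ} (hg : 0 ≤ g) {T : ℝ} (hT : 0 < T) :
    momentTwo d g T ≤ ENNReal.ofReal (d * Real.exp (6 * d * T)) := by
  have hterm : ∀ k : ℕ, ∑ x ∈ box d k, ∑ ω ∈ (zdGraph d).finsetWalkLength k (0 : Site d) x,
      ENNReal.ofReal (normSq x) * pathIntegral g T ω ≤
      ENNReal.ofReal d * ENNReal.ofReal ((4 * (2 * d) * T) ^ k / k !) := by
    intro k
    refine (momentLayer_le d k hg hT).trans ?_
    have h4 : ENNReal.ofReal (d * (k : ℝ) ^ 2) ≤ ENNReal.ofReal d * ENNReal.ofReal (4 ^ k) := by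
      rw [← ENNReal.ofReal_mul (Nat.cast_nonneg d)]
      exact ENNReal.ofReal_le_ofReal
        (mul_le_mul_of_nonneg_left (sq_le_four_pow k) (Nat.cast_nonneg d))
    calc ENNReal.ofReal (d * (k : ℝ) ^ 2) * ((2 * d : ℝ≥0∞) ^ k * ENNReal.ofReal (T ^ k / k !))
        ≤ ENNReal.ofReal d * ENNReal.ofReal (4 ^ k) *
            ((2 * d : ℝ≥0∞) ^ k * ENNReal.ofReal (T ^ k / k !)) := mul_le_mul' h4 le_rfl
      _ = ENNReal.ofReal d * ENNReal.ofReal ((4 * (2 * d) * T) ^ k / k !) := by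
          rw [mul_assoc, layerConst_eq d k T]
  unfold momentTwo weightedExpectation
  calc ENNReal.ofReal (Real.exp (-(2 * d) * T)) *
        ∑' k, ∑ x ∈ box d k, ∑ ω ∈ (zdGraph d).finsetWalkLength k (0 : Site d) x,
          ENNReal.ofReal (normSq x) * pathIntegral g T ω
      ≤ ENNReal.ofReal (Real.exp (-(2 * d) * T)) *
          ∑' k : ℕ, ENNReal.ofReal d * ENNReal.ofReal ((4 * (2 * d) * T) ^ k / k !) :=
        mul_le_mul' le_rfl (ENNReal.tsum_le_tsum hterm)
    _ = ENNReal.ofReal (d * Real.exp (6 * d * T)) := by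
        rw [ENNReal.tsum_mul_left, tsum_ofReal_pow_div_factorial_aux (by positivity),
          ← ENNReal.ofReal_mul (Nat.cast_nonneg d), ← ENNReal.ofReal_mul (Real.exp_pos _).le]
        congr 1
        rw [mul_left_comm, ← Real.exp_add]
        congr 2
        ring

/-- `E₀(e^{-gI(T)}|X(T)|²) < ∞` for `g ≥ 0`, `T > 0`.
[cite: BauerschmidtBrydgesSlade2015LogCorr, §1.3 (the measure E^{g,T}, p = 2)] -/
theorem momentTwo_lt_top (d : ℕ) {g : ℝ} (hg : 0 ≤ g) {T : ℝ} (hT : 0 < T) : momentTwo d g T < ∞ :=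
  lt_of_le_of_lt (momentTwo_le d hg hT) ENNReal.ofReal_lt_top

/-! ### `E₀(e^{-gI(T)}|X(T)|²) > 0` -/

/-- **`E₀(e^{-gI(T)}|X(T)|²) > 0`** for `d ≥ 1`, `T > 0` (every `g`): the one-step skeleton
`0 → e₀` ends at `|e₀|² = 1` and has a positive path integral.
[cite: BauerschmidtBrydgesSlade2015LogCorr, §1.3 (the measure E^{g,T}, p = 2)] -/
theorem momentTwo_pos (hd : 0 < d) (g : ℝ) {T : ℝ} (hT : 0 < T) : 0 < momentTwo d g T := by
  obtain ⟨e, he⟩ : ∃ e : Site d, e = Pi.single (⟨0, hd⟩ : Fin d) 1 := ⟨_, rfl⟩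
  have hadj : (zdGraph d).Adj (0 : Site d) e :=
    (zdGraph_adj_iff 0 e).2 ⟨⟨0, hd⟩, Or.inl (by rw [he, zero_add])⟩
  have hlen : (SimpleGraph.Walk.cons hadj SimpleGraph.Walk.nil : (zdGraph d).Walk (0 : Site d) e).length
      = 1 := by
    rw [SimpleGraph.Walk.length_cons, SimpleGraph.Walk.length_nil]
  have hmem : (SimpleGraph.Walk.cons hadj SimpleGraph.Walk.nil : (zdGraph d).Walk (0 : Site d) e) ∈
      (zdGraph d).finsetWalkLength 1 (0 : Site d) e :=
    SimpleGraph.mem_finsetWalkLength_iff.2 hlen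
  have hbox : e ∈ box d 1 := mem_box_of_walk (SimpleGraph.Walk.cons hadj SimpleGraph.Walk.nil) hlen.le
  have hnorm : 0 < normSq e := by
    unfold normSq
    refine lt_of_lt_of_le ?_ (Finset.single_le_sum (f := fun i => ((e i : ℝ)) ^ 2)
      (fun _ _ => sq_nonneg _) (Finset.mem_univ (⟨0, hd⟩ : Fin d)))
    rw [he, Pi.single_eq_same]
    norm_num
  unfold momentTwo weightedExpectation
  refine ENNReal.mul_pos (ENNReal.ofReal_pos.2 (Real.exp_pos _)).ne' (ne_of_gt ?_)
  calc (0 : ℝ≥0∞) < ENNReal.ofReal (normSq e) *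
        pathIntegral g T (SimpleGraph.Walk.cons hadj SimpleGraph.Walk.nil) :=
        ENNReal.mul_pos (ENNReal.ofReal_pos.2 hnorm).ne' (pathIntegral_pos g hT _).ne'
    _ ≤ ∑ ω ∈ (zdGraph d).finsetWalkLength 1 (0 : Site d) e,
          ENNReal.ofReal (normSq e) * pathIntegral g T ω :=
        Finset.single_le_sum (f := fun ω => ENNReal.ofReal (normSq e) * pathIntegral g T ω)
          (fun _ _ => bot_le) hmem
    _ ≤ ∑ x ∈ box d 1, ∑ ω ∈ (zdGraph d).finsetWalkLength 1 (0 : Site d) x,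
          ENNReal.ofReal (normSq x) * pathIntegral g T ω :=
        Finset.single_le_sum (f := fun x => ∑ ω ∈ (zdGraph d).finsetWalkLength 1 (0 : Site d) x,
          ENNReal.ofReal (normSq x) * pathIntegral g T ω) (fun _ _ => bot_le) hbox
    _ ≤ ∑' k, ∑ x ∈ box d k, ∑ ω ∈ (zdGraph d).finsetWalkLength k (0 : Site d) x,
          ENNReal.ofReal (normSq x) * pathIntegral g T ω :=
        ENNReal.le_tsum (f := fun k => ∑ x ∈ box d k,
          ∑ ω ∈ (zdGraph d).finsetWalkLength k (0 : Site d) x,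
            ENNReal.ofReal (normSq x) * pathIntegral g T ω) 1

/-! ### The mean-square displacement is a genuine positive real -/

/-- `E₀^{g,T}|X(T)|² = E₀(e^{-gI(T)}|X(T)|²) / E₀(e^{-gI(T)})` as a quotient of real numbers.
[cite: BauerschmidtBrydgesSlade2015LogCorr, §1.3 (the measure E^{g,T})] -/
theorem meanSqDisplacement_eq_div (d : ℕ) (g T : ℝ) :
    meanSqDisplacement d g T = (momentTwo d g T).toReal / (survival d g T).toReal :=
  ENNReal.toReal_div _ _

/-- The mean-square displacement is non-negative. [cite: BauerschmidtBrydgesSlade2015LogCorr, §1.3 (the measure E^{g,T})] -/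
theorem meanSqDisplacement_nonneg (d : ℕ) (g T : ℝ) : 0 ≤ meanSqDisplacement d g T :=
  ENNReal.toReal_nonneg

/-- **`0 < E₀^{g,T}|X(T)|² < ∞` is a genuine positive real** for `d ≥ 1`, `g ≥ 0`, `T > 0`:
numerator in `(0, ∞)` (`momentTwo_pos`, `momentTwo_lt_top`), denominator in `(0, 1]`
(`survival_pos`, `survival_le_one`). In particular the subject `meanSqDisplacement 4 g T` of the
open conjecture `BBS2015_endToEndConjecture` is not a junk value.
[cite: BauerschmidtBrydgesSlade2015LogCorr, §1.3 (the measure E^{g,T}, p = 2)] -/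
theorem meanSqDisplacement_pos (hd : 0 < d) {g : ℝ} (hg : 0 ≤ g) {T : ℝ} (hT : 0 < T) :
    0 < meanSqDisplacement d g T := by
  unfold meanSqDisplacement
  refine ENNReal.toReal_pos ?_ ?_
  · exact (ENNReal.div_pos_iff.2 ⟨(momentTwo_pos hd g hT).ne',
      (lt_of_le_of_lt (survival_le_one hg d hT) ENNReal.one_lt_top).ne⟩).ne'
  · exact ENNReal.div_ne_top (momentTwo_lt_top d hg hT).ne (survival_ne_zero d g hT)

end Literature.Barriers.CriticalPhenomena.CTWSAW
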